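import Summits.ResolutionOfSingularities.ResolutionOfSingularities.Theses.RisoStrata
import Summits.ResolutionOfSingularities.ResolutionOfSingularities.Theorems.RisoStrataRisoGlobalisationTower
import Summits.ResolutionOfSingularities.ResolutionOfSingularities.Theorems.RisoStrataRisoGlobalisationCentres
import Summits.ResolutionOfSingularities.ResolutionOfSingularities.Theorems.RisoStrataRisoGlobalisationGraphModel
import Literature.AlgebraicGeometry.Resolution.ProjectiveModelsCharts
import Literature.AlgebraicGeometry.Resolution.ResolutionProjectiveReduction
import Literature.AlgebraicGeometry.Motives.SegreEmbeddingPoints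

/-!
# Route RisoStrata — crux `RisoGlobalisation` (stmt-ResolutionOfSingularities-18547)

Line SketchIdeator1 (card segre-representation with the graph-closure exit of card
graph-closure-vector), glue part 3 of 3 and the crux by name.

* `risoGlob_hasResolution_of_isClosedImmersion_projectiveSpace` — the projective integral case:
  `X ⊆ ℙⁿ_k` as a projective model `M₀ = ProjModel.ofChart` of its function field `K`
  (verbatim from the tree's `hasResolution_of_twoModelPatching_of_dim_three`), homogeneous
  coordinates `w` of the generic point, `K = k(hᵢ/hⱼ)` for the nonzero ones `h`, the schedule
  hypothesis for `h`, the tower inside `K` (`risoGlob_towerInduction`) giving `u`, the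
  graph-closure model `P → M₀` of `(gen, [u])` with Segre coordinates `w ⊗ u`
  (leaf `stub_graphModel`), every centre of `P` regular (unit trick + part 2), exit by
  `ProjModel.isRegular_of_forall_regCentre` and `ProjModel.Hom.hasResolution`;
* `risoGlobalisation_core` — the predicate-generic globalisation (Chow's lemma
  `ChowLemmaIntegral_holds` + `exists_projectiveClosure` + transfer of resolutions);
* `RisoGlobalisation_of` — the crux, by instantiating the cut predicate at
  `P B m d := ¬ Rtd B m (d + 1)` (the `let`s of the Theses file unfold definitionally to the
  route's Defs).
-/

-- single-problem summit: the doubled namespace component `ResolutionOfSingularities` is forced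
set_option linter.dupNamespace false

namespace Summit.ResolutionOfSingularities.ResolutionOfSingularities.Theorems

open AlgebraicGeometry CategoryTheory
open Literature.AlgebraicGeometry.Resolution Literature.AlgebraicGeometry.Motives

attribute [local instance] MvPolynomial.gradedAlgebra

/-! ## Assembly: the resolving model of an integral closed subscheme of `ℙⁿ_k` -/

section Assembly

variable {k : Type} [Field k]

/-- **The projective integral case.**  For an integral closed subscheme `X ⊆ ℙⁿ_k`: make `X`
a projective model `M₀` of its function field `K` (an affine chart `Spec A`,
`ProjModel.ofChart`, as in the tree's `hasResolution_of_twoModelPatching_of_dim_three`), take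
homogeneous coordinates `w` of its generic point, apply H₂ to the vector `h` of NONZERO
coordinates (`K = k(hᵢ/hⱼ)` by the chart computation at the generic point), run the tower inside
`K` (`risoGlob_towerInduction`) to get `u`, form the graph-closure model `P → M₀` of `(gen, [u])`
(`stub_graphModel`) with Segre coordinates `w ⊗ u`, and read the local ring at the centre of
every valuation `v` as the localisation of the `𝒪_v`-minimal chart `k[u_α/u_γ]` (the chart
`(β, γ)` of `w ⊗ u`, `β` with `k[hᵢ/h_β] ⊆ k[u_α/u_γ]`, contains the centre: unit trick +
`stub_chartMem`), which is regular by the conclusion of the tower; conclude by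
`isRegular_of_forall_regCentre` and `Hom.hasResolution`. -/
theorem risoGlob_hasResolution_of_isClosedImmersion_projectiveSpace
    (P : ∀ (K : Type) [Field K] [Algebra k K] (B : Subalgebra k K), Ideal ↥B → ℕ → Prop)
    (hloc : ∀ (K : Type) [Field K] [Algebra k K], RisoLocal (P K))
    (hres : ∀ (K : Type) [Field K] [Algebra k K] (N : ℕ) (h : Fin (N + 1) → K),
      (∀ i, h i ≠ 0) →
      IntermediateField.adjoin k
          (Set.range fun ij : Fin (N + 1) × Fin (N + 1) => h ij.1 * (h ij.2)⁻¹) = ⊤ →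
        RisoSchedule (P K) N h)
    {n : ℕ} (X : Scheme.{0}) [IsIntegral X] (c : X ⟶ (Literature.AlgebraicGeometry.Motives.projectiveSpace n k).left)
    [IsClosedImmersion c] : Scheme.HasResolution X := by
  classical
  haveI : IsProper (Literature.AlgebraicGeometry.Motives.projectiveSpace n k).hom := Literature.AlgebraicGeometry.Motives.isProper_projectiveSpace n k
  let πX : X ⟶ Spec (.of k) := c ≫ (Literature.AlgebraicGeometry.Motives.projectiveSpace n k).hom
  have hproj : Literature.AlgebraicGeometry.Motives.IsProjectiveOver (Over.mk πX) := ⟨n, Over.homMk c rfl, ‹_›⟩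
  haveI : LocallyOfFiniteType πX := inferInstance
  /- an affine chart `U = Spec A` of `X` and `X` as a projective model of `K = Frac A`
    (verbatim from `hasResolution_of_twoModelPatching_of_dim_three`) -/
  obtain ⟨_, ⟨U', hU', rfl⟩, hηU, -⟩ := X.isBasis_affineOpens.exists_subset_of_mem_open
    (Set.mem_univ (genericPoint X)) isOpen_univ
  let U : X.Opens := U'
  have hU : IsAffineOpen U := hU'
  haveI : IsAffine U := hU
  haveI : Nonempty U := ⟨⟨_, hηU⟩⟩
  let A : Type := Γ(U, ⊤)
  let g : (U : Scheme.{0}) ⟶ Spec (.of k) := U.ι ≫ πX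
  let ψ : k →+* A := g.appTop.hom.comp (Scheme.ΓSpecIso (.of k)).inv.hom
  have hψ : ψ.FiniteType := by
    have h1 : g.appTop.hom.FiniteType :=
      (HasRingHomProperty.iff_of_isAffine (P := @LocallyOfFiniteType)).mp inferInstance
    exact h1.comp (RingHom.FiniteType.of_surjective _
      (Scheme.ΓSpecIso (.of k)).symm.commRingCatIsoToRingEquiv.surjective)
  letI : Algebra k A := ψ.toAlgebra
  haveI hft : Algebra.FiniteType k A := hψ
  let K : Type := FractionRing A
  let j : Spec (.of A) ⟶ X := U.toScheme.isoSpec.inv ≫ U.ι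
  have hj : j ≫ πX = Spec.map (CommRingCat.ofHom (algebraMap k A)) := by
    change (U.toScheme.isoSpec.inv ≫ U.ι) ≫ πX = Spec.map (CommRingCat.ofHom ψ)
    rw [Category.assoc, isoSpec_inv_comp]
    rfl
  let M₀ : ProjModel k K := ProjModel.ofChart (K := K) X πX hproj A j hj
  /- homogeneous coordinates of the generic point and the vector `h` of the nonzero ones -/
  obtain ⟨n', ιM, hιMci, hιM, w, hw, hgenM⟩ := M₀.exists_coords
  haveI := hιMci
  have hSne : Nonempty {i : Fin (n' + 1) // w i ≠ 0} := by
    obtain ⟨i, hi⟩ := Function.ne_iff.mp hw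
    exact ⟨⟨i, hi⟩⟩
  obtain ⟨N, hN⟩ : ∃ N : ℕ, Fintype.card {i : Fin (n' + 1) // w i ≠ 0} = N + 1 :=
    Nat.exists_eq_succ_of_ne_zero Fintype.card_ne_zero
  let eS : Fin (N + 1) ≃ {i : Fin (n' + 1) // w i ≠ 0} := (Fintype.equivFinOfCardEq hN).symm
  let h : Fin (N + 1) → K := fun a => w (eS a).1
  have hh : ∀ a, h a ≠ 0 := fun a => (eS a).2
  have hratio : ∀ (i : Fin (n' + 1)) (β : Fin (N + 1)),
      w i * (w (eS β).1)⁻¹ ∈ Algebra.adjoin k (Set.range fun a => h a * (h β)⁻¹) := by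
    intro i β
    by_cases hwi : w i = 0
    · rw [hwi, zero_mul]; exact Subalgebra.zero_mem _
    · refine Algebra.subset_adjoin ⟨eS.symm ⟨i, hwi⟩, ?_⟩
      simp only [h, Equiv.apply_symm_apply]
  /- `K = k(hᵢ/hⱼ)`: the local ring at the generic point is `K` and lies on a chart -/
  have hgenK : IntermediateField.adjoin k
      (Set.range fun ij : Fin (N + 1) × Fin (N + 1) => h ij.1 * (h ij.2)⁻¹) = ⊤ := by
    set F := IntermediateField.adjoin k
      (Set.range fun ij : Fin (N + 1) × Fin (N + 1) => h ij.1 * (h ij.2)⁻¹) with hF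
    have hξ : M₀.stalkSubring (genericPoint M₀.X) = ⊤ := M₀.stalkSubring_genericPoint
    set i₀ : Fin (n' + 1) := (eS 0).1 with hi₀def
    have hi₀ : w i₀ ≠ 0 := (eS 0).2
    have hCF : ∀ z ∈ Algebra.adjoin k (Set.range fun α => w α * (w i₀)⁻¹), z ∈ F := by
      intro z hz
      refine risoGlob_adjoin_le_subring (T := F.toSubalgebra.toSubring) (fun c => F.algebraMap_mem c) ?_ hz
      rintro _ ⟨α, rfl⟩
      have hmem := hratio α 0
      refine risoGlob_adjoin_le_subring (T := F.toSubalgebra.toSubring) (fun c => F.algebraMap_mem c)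
        ?_ hmem
      rintro _ ⟨a, rfl⟩
      exact IntermediateField.subset_adjoin k _ ⟨(a, 0), rfl⟩
    have hξU : genericPoint M₀.X ∈ GeneratingSections.preU ιM i₀ :=
      stub_chartMem M₀ ιM hιM w hw hgenM i₀ hi₀ (genericPoint M₀.X)
        (fun α => by rw [hξ]; exact Subring.mem_top _)
    rw [eq_top_iff]
    intro z _
    obtain ⟨a, ha, s, hs, -, rfl⟩ := stub_chartRing M₀ ιM hιM w hw hgenM i₀ (genericPoint M₀.X)
      hξU z (by rw [hξ]; exact Subring.mem_top _)
    exact mul_mem (hCF a ha) (inv_mem (hCF s hs))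
  /- H₂ for `h`, and the tower inside `K` -/
  obtain ⟨sched, hsched⟩ := hres K N h hh hgenK
  obtain ⟨N', u, hu, hcharts, hreg⟩ := risoGlob_towerInduction (P K) (hloc K) sched N h hh hsched
  have hu' : u ≠ 0 := fun h0 => hu 0 (congr_fun h0 0)
  /- the graph-closure model `P → M₀` with Segre coordinates `w ⊗ u` -/
  obtain ⟨Pm, φ, ιP, hιPci, hιP, hgenP⟩ := stub_graphModel M₀ ιM hιM w hw hgenM u hu'
  haveI := hιPci
  set e := segreIndexEquiv n' N' with hedef
  set wu : Fin (n' * N' + n' + N' + 1) → K := fun t => w (e.symm t).1 * u (e.symm t).2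
    with hwudef
  have hwu : wu ≠ 0 := ProjectiveSpace.segreVec_ne_zero hw hu'
  have hwu_e : ∀ i a, wu (e (i, a)) = w i * u a := fun i a => by
    simp only [hwudef, Equiv.symm_apply_apply]
  /- every centre of `P` is regular -/
  have hPreg : ∀ v : ZariskiRiemannSpace k K, Pm.RegCentre v := by
    intro v
    set O := v.asValuationSubring with hO
    have hkO : ∀ c' : k, algebraMap k K c' ∈ O := v.algebraMap_mem
    -- the `O`-minimal chart `γ` of `u`, and `β` with `k[hᵢ/h_β] ⊆ k[u_α/u_γ]`
    obtain ⟨γ, -, hγO⟩ := definedOn_valuationSubring (w := u) ⟨0, hu 0⟩ O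
    have hγO' : ∀ α, u α * (u γ)⁻¹ ∈ O := fun α => by
      simpa only [div_eq_mul_inv, ValuationSubring.mem_toSubring] using hγO α
    have hCγO : ∀ z ∈ Algebra.adjoin k (Set.range fun α => u α * (u γ)⁻¹), z ∈ O :=
      fun z hz => risoGlob_adjoin_le_of_subset hkO (by rintro _ ⟨α, rfl⟩; exact hγO' α) hz
    obtain ⟨β, hβ⟩ := hcharts γ
    -- the centre and a chart `t₀` through it
    set y := Pm.centre v with hy
    have hdom : SubringDominates (Pm.stalkSubring y) O.toSubring := Pm.isCentreOf_centre v
    obtain ⟨t₀, ht₀, hdef⟩ :=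
      ProjModel.HasCentre.definedOn Pm ιP hιP wu hwu hgenP ⟨y, Pm.isCentreOf_self y⟩
    -- the chart `t₁ = (β, γ)` also contains the centre (unit trick)
    set t₁ := e ((eS β).1, γ) with ht₁def
    have ht₁ : wu t₁ ≠ 0 := by rw [ht₁def, hwu_e]; exact mul_ne_zero (hh β) (hu γ)
    obtain ⟨⟨i, α⟩, hiα⟩ : ∃ p, e p = t₀ := ⟨e.symm t₀, e.apply_symm_apply t₀⟩
    have hwi : w i ≠ 0 := by
      have ht₀' := ht₀
      rw [← hiα, hwu_e] at ht₀'
      exact left_ne_zero_of_mul ht₀'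
    have hT : wu t₀ * (wu t₁)⁻¹ ∈ O := by
      have e1 : wu t₀ * (wu t₁)⁻¹ = (w i * (w (eS β).1)⁻¹) * (u α * (u γ)⁻¹) := by
        rw [← hiα, ht₁def, hwu_e, hwu_e, mul_inv]
        ring
      rw [e1]
      exact mul_mem (hCγO _ (hβ (hratio i β))) (hγO' α)
    have hTinv : (wu t₀ * (wu t₁)⁻¹)⁻¹ ∈ Pm.stalkSubring y := by
      rw [mul_inv, inv_inv, mul_comm, ← div_eq_mul_inv]
      exact hdef t₁
    have hTy : wu t₀ * (wu t₁)⁻¹ ∈ Pm.stalkSubring y := by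
      have := hdom.2 _ hTinv (by rw [inv_inv]; exact hT)
      rwa [inv_inv] at this
    have hmem : ∀ t, wu t * (wu t₁)⁻¹ ∈ Pm.stalkSubring y := fun t => by
      have e1 : (wu t / wu t₀) * (wu t₀ * (wu t₁)⁻¹) = wu t * (wu t₁)⁻¹ := by
        rw [← mul_assoc, div_mul_cancel₀ _ ht₀]
      rw [← e1]
      exact mul_mem (hdef t) hTy
    -- the chart ring at `t₁` IS `k[u_α/u_γ]`
    have hCeq : Algebra.adjoin k (Set.range fun t => wu t * (wu t₁)⁻¹) =
        Algebra.adjoin k (Set.range fun α => u α * (u γ)⁻¹) := by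
      apply le_antisymm
      · refine Algebra.adjoin_le ?_
        rintro _ ⟨t, rfl⟩
        obtain ⟨⟨i', α'⟩, rfl⟩ : ∃ p, e p = t := ⟨e.symm t, e.apply_symm_apply t⟩
        have e1 : wu (e (i', α')) * (wu t₁)⁻¹ =
            (w i' * (w (eS β).1)⁻¹) * (u α' * (u γ)⁻¹) := by
          rw [ht₁def, hwu_e, hwu_e, mul_inv]
          ring
        change wu (e (i', α')) * (wu t₁)⁻¹ ∈ Algebra.adjoin k (Set.range fun α => u α * (u γ)⁻¹)
        rw [e1]
        exact mul_mem (hβ (hratio i' β)) (Algebra.subset_adjoin ⟨α', rfl⟩)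
      · refine Algebra.adjoin_le ?_
        rintro _ ⟨α', rfl⟩
        refine risoGlob_mem_chart_of_eq wu t₁ (e ((eS β).1, α')) ?_
        rw [ht₁def, hwu_e, hwu_e, mul_inv, mul_mul_mul_comm, mul_inv_cancel₀ (hh β), one_mul]
    -- regularity at the centre of `v`
    refine risoGlob_regCentre_of_isRegularLocalRing_risoLoc Pm ιP hιP wu hwu hgenP v t₁ ht₁ hmem ?_
    rw [hCeq]
    exact hreg O hkO γ hγO'
  exact φ.hasResolution (ProjModel.isRegular_of_forall_regCentre hPreg)

/-- **Generic globalisation** (the former lead-held stub `stub_core`, now proved): Chow's lemma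
(`ChowLemmaIntegral_holds`) and the projective closure (`exists_projectiveClosure`) reduce to
the projective integral case, and resolutions descend along proper birational morphisms and
restrict to opens. -/
theorem risoGlobalisation_core
    (P : ∀ (K : Type) [Field K] [Algebra k K] (B : Subalgebra k K), Ideal ↥B → ℕ → Prop)
    (hloc : ∀ (K : Type) [Field K] [Algebra k K], RisoLocal (P K))
    (hres : ∀ (K : Type) [Field K] [Algebra k K] (N : ℕ) (h : Fin (N + 1) → K),
      (∀ i, h i ≠ 0) →
      IntermediateField.adjoin k
          (Set.range fun ij : Fin (N + 1) × Fin (N + 1) => h ij.1 * (h ij.2)⁻¹) = ⊤ →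
        RisoSchedule (P K) N h)
    (X : Scheme.{0}) (f : X ⟶ Spec (.of k)) [IsSeparated f] [LocallyOfFiniteType f]
    [QuasiCompact f] [IsIntegral X] : Scheme.HasResolution X := by
  obtain ⟨n, X', π, ι, hint', hι, hπ, -, -, U, hU, hU', hiso⟩ :=
    ChowLemmaIntegral_holds k X f inferInstance inferInstance inferInstance inferInstance
  haveI := hπ
  haveI := hι
  haveI := hint'
  have hbir : IsBirational π := ⟨U, hU, hU', hiso⟩
  obtain ⟨Xbar, j, c, hXbar, hj, hc, -, -⟩ := exists_projectiveClosure ι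
  haveI := hj
  haveI := hc
  haveI := hXbar
  have hresbar : Scheme.HasResolution Xbar :=
    risoGlob_hasResolution_of_isClosedImmersion_projectiveSpace P hloc hres Xbar c
  exact Scheme.HasResolution.of_isBirational π hbir (hresbar.of_isOpenImmersion j)

end Assembly

/-! ## The crux by name -/

/-- **`RisoGlobalisation`** (crux stmt-ResolutionOfSingularities-18547) from the generic core:
instantiate the cut predicate at `P B m d := ¬ Rtd B m (d + 1)`, the route's
riso-triviality-dimension cut (written out as a closed term; the `let`-bound `Arc`, `Rtd`,
`Cen`, `step`, `Valid`, `stage`, `loc` of the Theses file unfold to it definitionally). -/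
theorem RisoGlobalisation_of :
    Summit.ResolutionOfSingularities.ResolutionOfSingularities.Theses.RisoStrata.RisoGlobalisation := by
  intro p hp hloc hres k _ _ _ X f hsep hft hqc hint
  haveI := hsep; haveI := hft; haveI := hqc; haveI := hint
  exact risoGlobalisation_core
    (P := fun (K : Type) (_ : Field K) (_ : Algebra k K) (B : Subalgebra k K) (m : Ideal ↥B)
      (d : ℕ) => ¬ ((fun (r : ℕ) => (∃ (n : ℕ) (g : Fin n → ↥B), (∀ i, g i ∈ m) ∧
        Algebra.adjoin k (Set.range fun i => (g i : K)) = B ∧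
        ∃ W : Submodule k (Fin n → k), r ≤ Module.finrank k ↥W ∧
        ∃ φ : {α : ↥B →ₐ[k] HahnSeries ℚ k // ∀ b ∈ m, 0 < (α b).orderTop} →
          (Fin n → HahnSeries ℚ k),
        (∀ a b : {α : ↥B →ₐ[k] HahnSeries ℚ k // ∀ b ∈ m, 0 < (α b).orderTop}, a ≠ b →
          ∃ j, ∀ i, (a.1 (g j) - b.1 (g j)).orderTop <
            ((φ a i - φ b i) - (a.1 (g i) - b.1 (g i))).orderTop) ∧
        (∀ a i, 0 < (φ a i).orderTop) ∧
        (∀ a, ∀ w : Fin n → HahnSeries ℚ k, (∀ i, 0 < (w i).orderTop) →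
          w ∈ Submodule.span (HahnSeries ℚ k)
            ((fun u : Fin n → k => fun i => HahnSeries.C (u i)) '' (W : Set (Fin n → k))) →
          ∃ b, φ b = φ a + w))) (d + 1)))
    (fun K _ _ => by
      intro B s hs hs0 hfg m' hm' d
      exact not_congr (hloc k K B s hs hs0 hfg m' hm' (d + 1)))
    (fun K _ _ N h hh hgen => hres k K N h hh hgen) X f

end Summit.ResolutionOfSingularities.ResolutionOfSingularities.Theorems
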